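import Literature.MathematicalPhysics.QuantumLattice.HubbardNNNHoppingOpenClusters
import HarnessLib
import HarnessLib.Audit

/-!
# Hubbard ladder — Bounds: the `a → ∞` strip limit of the open-box consumer (`t–t'–U` Hubbard model)

HONEST FRAMING (cell pub-hubbard): ladder R1–R4 with certified numbers; no claim on H/H₀; bounds for model
classes, no materials claim.

The tree's open-box consumer `ThermodynamicLimit.energyDensityTT'_le_openBox`
(`Literature/MathematicalPhysics/QuantumLattice/HubbardNNNHoppingOpenClusters.lean`, ledger p198951) turns ONE
open `a × b` cluster with `N < 2ab` particles into the thermodynamic-limit row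
`e(t,t',U; N/(ab)) ≤ E_open(a × b; N)/(ab)` (periodic tiling of large tori by product states: inter-box hopping
expectations vanish by particle-number superselection; Ruelle 1969 §3.3). This file adds the LIMIT IN THE BOX
LENGTH at fixed width `b` — the consumer for translation-invariant STRIP states (a uniform matrix-product state
of the infinite strip `ℤ × {1,…,b}` cut to length `a` with boundary vectors carries exactly `n·a·b` particles
along an arithmetic progression of lengths and has energy `≤ c·(a·b) + C` with an `a`-INDEPENDENT boundary
constant `C`; hubbard-alg L3 `DESIGN.md` §5 A6(ii), 'U1-strip' rows):

* `energyDensityTT'_le_of_openBox_linear` — if for INFINITELY MANY lengths `a` the open `a × b` box carries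
  `N_a = n·a·b` particles (exact density) with `E_open(a × b; N_a) ≤ c·(a·b) + C`, then `e(t,t',U; n) ≤ c`
  (`U ≥ 0`, `n < 2`): each such `a` gives `e(n) ≤ c + C/(ab)` by the open-box consumer, and `C/(ab) → 0`;
* `energyDensityTT'_le_of_openBox_linear_mul` — the same along an arithmetic progression `a = k·q`, `k ≥ k₀`
  (the cell period `q` of the strip state);
* `energyDensityTT'_le_of_re_expect_openBox_linear` — the variational form: unit `N_a`-particle vectors
  `φ_a` of the open boxes with `Re⟨φ_a, H_open(a × b) φ_a⟩ ≤ c·(a·b) + C` for infinitely many `a`.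

No new objects; three corollaries of the landed consumer and `HubbardWave0.groundEnergy_le_re_expect`.
What is NOT here (and not needed for it): a cylinder Hamiltonian, or the strip-state energy theorem itself
(the multi-site-cell uMPS bound 'Theorem U1-strip' is the Venture tree's, `Summits/Ventures/CertifiedManyBodySolver/Upper/`).
Density mixing over FILLINGS of one box shape (A6(i)) is already the landed
`ThermodynamicLimit.energyDensityTT'_le_openBox_pattern` (consumed by `Bounds/OpenClusterTLUpperRows*.lean`).
Sources: Ruelle, Statistical Mechanics (1969) §3.3 [Ruelle1969]; LeBlanc et al., Phys. Rev. X 5 (2015) 041041, eq. (1)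
(the `t–t'` model on open clusters) [LeBlancEtAl2015]; Tasaki (2020) §2.1 (variational principle) [Tasaki2020].
-/

noncomputable section

namespace Summit.HubbardSuperconductivity.HubbardLadder.Bounds

open Filter Matrix
open Literature.MathematicalPhysics.QuantumLattice
open Literature.MathematicalPhysics.QuantumLattice.HubbardWave0
open Literature.MathematicalPhysics.QuantumLattice.ThermodynamicLimit
open scoped ComplexOrder

/-- **Strip limit of the open-box consumer (`a → ∞` at fixed width `b`).** Let `U ≥ 0`, `b ≥ 1`, `n < 2`,
reals `c, C` and particle numbers `N : ℕ → ℕ`. If for infinitely many box lengths `a` the open `a × b` cluster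
`hubbardOpenBoxTT' a b t t' U` carries `N a` particles at exact density `n` (`N a = n·a·b`) with the linear
energy bound `E_open(a × b; N a) ≤ c·(a·b) + C`, then `e(t, t', U; n) ≤ c`: for each such `a ≥ 1` the
open-box consumer `energyDensityTT'_le_openBox` gives `e(n) ≤ c + C/(ab) ≤ c + |C|/a`, and `a` is
arbitrarily large. Ruelle (1969) §3.3 (the thermodynamic limit is an infimum over boxes), for the model of
LeBlanc et al. (2015) eq. (1). [cite: Ruelle1969, §3.3] -/
theorem energyDensityTT'_le_of_openBox_linear (t t' : ℝ) {U : ℝ} (hU : 0 ≤ U) {b : ℕ} (hb : 1 ≤ b)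
    {n : ℝ} (hn2 : n < 2) (c C : ℝ) (N : ℕ → ℕ)
    (h : ∃ᶠ a : ℕ in atTop, ((N a : ℕ) : ℝ) = n * ((a : ℝ) * (b : ℝ)) ∧
      groundEnergy (hubbardOpenBoxTT' a b t t' U) (N a) ≤ c * ((a : ℝ) * (b : ℝ)) + C) :
    energyDensityTT' t t' U n ≤ c := by
  refine le_of_forall_pos_le_add fun ε hε => ?_
  -- a length `a ≥ max 1 (|C|/ε)` at which the hypothesis holds
  obtain ⟨a, ha, hNa, hEa⟩ : ∃ a : ℕ, max 1 (|C| / ε) ≤ (a : ℝ) ∧ ((N a : ℕ) : ℝ) = n * ((a : ℝ) * (b : ℝ)) ∧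
      groundEnergy (hubbardOpenBoxTT' a b t t' U) (N a) ≤ c * ((a : ℝ) * (b : ℝ)) + C := by
    obtain ⟨a, ha, hP⟩ := (Filter.frequently_atTop.1 h) (⌈max 1 (|C| / ε)⌉₊)
    exact ⟨a, (Nat.le_ceil _).trans (by exact_mod_cast ha), hP.1, hP.2⟩
  have ha1 : (1 : ℝ) ≤ (a : ℝ) := (le_max_left _ _).trans ha
  have haC : |C| / ε ≤ (a : ℝ) := (le_max_right _ _).trans ha
  have ha1' : 1 ≤ a := by exact_mod_cast ha1
  have hb1 : (1 : ℝ) ≤ (b : ℝ) := by exact_mod_cast hb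
  have hab : (0 : ℝ) < (a : ℝ) * (b : ℝ) := by positivity
  -- `N a < 2ab`
  have hNlt : N a < 2 * (a * b) := by
    have h1 : ((N a : ℕ) : ℝ) < 2 * ((a : ℝ) * (b : ℝ)) := by
      rw [hNa]; exact mul_lt_mul_of_pos_right hn2 hab
    exact_mod_cast h1
  -- the open-box consumer at this `a`
  have hcons := energyDensityTT'_le_openBox t t' hU ha1' hb hNlt
  have hdens : ((N a : ℕ) : ℝ) / ((a : ℝ) * (b : ℝ)) = n := by
    rw [hNa, mul_div_assoc, div_self hab.ne', mul_one]
  rw [hdens] at hcons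
  -- `E/(ab) ≤ c + C/(ab) ≤ c + |C|/a ≤ c + ε`
  have hCab : C / ((a : ℝ) * (b : ℝ)) ≤ ε := by
    have h1 : C / ((a : ℝ) * (b : ℝ)) ≤ |C| / ((a : ℝ) * (b : ℝ)) :=
      div_le_div_of_nonneg_right (le_abs_self C) hab.le
    have h2 : |C| / ((a : ℝ) * (b : ℝ)) ≤ |C| / (a : ℝ) := by
      apply div_le_div_of_nonneg_left (abs_nonneg C) (by positivity)
      calc (a : ℝ) = (a : ℝ) * 1 := (mul_one _).symm
        _ ≤ (a : ℝ) * (b : ℝ) := mul_le_mul_of_nonneg_left hb1 (by positivity)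
    have h3 : |C| / (a : ℝ) ≤ ε := by
      rw [div_le_iff₀ (by positivity)]
      have := (div_le_iff₀ hε).1 haC
      linarith [this]
    linarith
  calc energyDensityTT' t t' U n
      ≤ groundEnergy (hubbardOpenBoxTT' a b t t' U) (N a) / ((a : ℝ) * (b : ℝ)) := hcons
    _ ≤ (c * ((a : ℝ) * (b : ℝ)) + C) / ((a : ℝ) * (b : ℝ)) := div_le_div_of_nonneg_right hEa hab.le
    _ = c + C / ((a : ℝ) * (b : ℝ)) := by
        rw [add_div, mul_div_assoc, div_self hab.ne', mul_one]
    _ ≤ c + ε := by linarith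

/-- **Strip limit along an arithmetic progression of lengths** `a = k·q` (`q ≥ 1` the cell period of the
strip state, `k ≥ k₀`): exact density `N k = n·(kq)·b` and `E_open((kq) × b; N k) ≤ c·((kq)·b) + C` for all
`k ≥ k₀` give `e(t, t', U; n) ≤ c` (`U ≥ 0`, `b ≥ 1`, `n < 2`). [cite: Ruelle1969, §3.3] -/
theorem energyDensityTT'_le_of_openBox_linear_mul (t t' : ℝ) {U : ℝ} (hU : 0 ≤ U) {b : ℕ} (hb : 1 ≤ b)
    {n : ℝ} (hn2 : n < 2) (c C : ℝ) {q : ℕ} (hq : 1 ≤ q) (k₀ : ℕ) (N : ℕ → ℕ)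
    (h : ∀ k : ℕ, k₀ ≤ k → ((N k : ℕ) : ℝ) = n * ((((k * q : ℕ) : ℝ)) * (b : ℝ)) ∧
      groundEnergy (hubbardOpenBoxTT' (k * q) b t t' U) (N k) ≤ c * (((k * q : ℕ) : ℝ) * (b : ℝ)) + C) :
    energyDensityTT' t t' U n ≤ c := by
  -- re-index the particle numbers by the length `a = k q` (on multiples of `q`)
  classical
  let N' : ℕ → ℕ := fun a => N (a / q)
  refine energyDensityTT'_le_of_openBox_linear t t' hU hb hn2 c C N' ?_
  refine Filter.frequently_atTop.2 fun a₀ => ?_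
  refine ⟨(max a₀ k₀) * q, ?_, ?_⟩
  · calc a₀ ≤ max a₀ k₀ := le_max_left _ _
      _ = max a₀ k₀ * 1 := (mul_one _).symm
      _ ≤ max a₀ k₀ * q := Nat.mul_le_mul_left _ hq
  · have hk : k₀ ≤ max a₀ k₀ := le_max_right _ _
    have hdiv : max a₀ k₀ * q / q = max a₀ k₀ := Nat.mul_div_cancel _ (by omega)
    have hN' : N' (max a₀ k₀ * q) = N (max a₀ k₀) := by simp only [N', hdiv]
    rw [hN']
    exact h _ hk

/-- **Variational form of the strip limit**: unit `N a`-particle vectors `φ a` of the open `a × b` boxes with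
exact density `N a = n·a·b` and `Re⟨φ a, H_open(a × b) φ a⟩ ≤ c·(a·b) + C` for infinitely many `a` give
`e(t, t', U; n) ≤ c` (`U ≥ 0`, `b ≥ 1`, `n < 2`) — the statement a translation-invariant strip certificate
(boundary-terminated uMPS of cell period dividing `a`, exactly evaluated energy linear in `a`) discharges.
[cite: Ruelle1969, §3.3] [cite: Tasaki2020, §2.1] -/
theorem energyDensityTT'_le_of_re_expect_openBox_linear (t t' : ℝ) {U : ℝ} (hU : 0 ≤ U) {b : ℕ}
    (hb : 1 ≤ b) {n : ℝ} (hn2 : n < 2) (c C : ℝ) (N : ℕ → ℕ)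
    (φ : (a : ℕ) → Fock (Orb (Fin a ×ₗ Fin b)))
    (h : ∃ᶠ a : ℕ in atTop, ((N a : ℕ) : ℝ) = n * ((a : ℝ) * (b : ℝ)) ∧ IsNParticle (N a) (φ a) ∧
      star (φ a) ⬝ᵥ (φ a) = 1 ∧
      (star (φ a) ⬝ᵥ (hubbardOpenBoxTT' a b t t' U *ᵥ φ a)).re ≤ c * ((a : ℝ) * (b : ℝ)) + C) :
    energyDensityTT' t t' U n ≤ c := by
  refine energyDensityTT'_le_of_openBox_linear t t' hU hb hn2 c C N (h.mono fun a ha => ?_)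
  obtain ⟨hNa, hφN, hφ1, hE⟩ := ha
  exact ⟨hNa, (groundEnergy_le_re_expect _ hφN hφ1).trans hE⟩


end Summit.HubbardSuperconductivity.HubbardLadder.Bounds

end
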